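import Literature.NumberTheory.Sieve.LenstraPomeranceCounting
import Mathlib.NumberTheory.AbelSummation
import Mathlib.Analysis.SpecialFunctions.Pow.Real
import Mathlib.Analysis.SpecialFunctions.Pow.Continuity
import Mathlib.Analysis.SpecialFunctions.Integrals.Basic
import HarnessLib

/-!
# `S(v, y; 𝒫)` from `π(x; 𝒫)` by partial summation: Lenstra–Pomerance 1992, Corollary 7.5

H. W. Lenstra Jr. and C. Pomerance, *A rigorous time bound for factoring integers*,
J. Amer. Math. Soc. **5** (1992) 483–516, §7 (p. 502). With `π(x; 𝒫) = #{p ≤ x : p ∈ 𝒫}` and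
`S(v, y; 𝒫) = ∑_{p ∈ 𝒫, v < p ≤ y} 1/p` as in §6 (tree: `primeCountIn`, `primeRecipSumIn` of
`LenstraPomeranceCounting`):

* **Theorem 7.4** (not proved here; it rests on Pomerance [28, Thm. B′] and Friedlander–Lagarias
  [12]): there is `c₇` with `π(x; 𝒮′) ≤ c₇ x exp(-½ (log x)^{1/6})` for all real `x ≥ 2`, where
  `𝒮′` is the set of primes at which the elliptic-curve smoothness test may fail.
* **Corollary 7.5.** For any two real numbers `v, y` with `2 ≤ v < y` we have
  `S(v, y; 𝒮′) < c₇ exp(-½ (log v)^{1/6}) · (1 + log(y/v))`, with `c₇` as in Theorem 7.4.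
  *Proof.* "Using partial summation and Theorem 7.4 we find
  `S(v, y; 𝒮′) = (1/y)(π(y; 𝒮′) - π(v; 𝒮′)) + ∫_v^y t⁻² (π(t; 𝒮′) - π(v; 𝒮′)) dt
  < c₇ exp(-½ (log v)^{1/6}) · (1 + ∫_v^y dt/t) = c₇ exp(-½ (log v)^{1/6}) · (1 + log(y/v))`."

Here Corollary 7.5 is proved as the implication "Theorem 7.4 ⟹ Corollary 7.5" for an ARBITRARY
set of primes `𝒫` (`primeRecipSumIn_lt_of_primeCountIn_le`): the hypothesis is the inequality of
Theorem 7.4 for `𝒫`, so that the corollary applies verbatim once Theorem 7.4 is available, and no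
named fact is introduced. The partial summation identity is `primeRecipSumIn_eq_sub_add_integral`
(Abel summation, Mathlib `sum_mul_eq_sub_sub_integral_mul`, with `f(t) = 1/t`).
Everything is proved; no definitions, no named facts.
-/

noncomputable section

open Finset MeasureTheory Set

namespace Literature.NumberTheory.Sieve
namespace LenstraPomerance

open Classical in
/-- The counting function `π(t; 𝒫)` as the partial sum of the indicator of `{p prime, p ∈ 𝒫}`.
[folklore] -/
theorem sum_Icc_indicator_eq_primeCountIn (P : Set ℕ) (t : ℝ) :
    ∑ k ∈ Icc 0 ⌊t⌋₊, (if k.Prime ∧ k ∈ P then (1 : ℝ) else 0) = primeCountIn P t := by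
  rw [Finset.sum_boole]
  unfold primeCountIn primesBelowIn
  congr 2

open Classical in
/-- `S(v, y; 𝒫)` as the sum `∑_{⌊v⌋ < k ≤ ⌊y⌋} k⁻¹ · 1_{k prime, k ∈ 𝒫}` (`0 ≤ v`). [folklore] -/
theorem primeRecipSumIn_eq_sum_Ioc (P : Set ℕ) {v y : ℝ} (hv : 0 ≤ v) :
    primeRecipSumIn P v y =
      ∑ k ∈ Finset.Ioc ⌊v⌋₊ ⌊y⌋₊, (k : ℝ)⁻¹ * (if k.Prime ∧ k ∈ P then (1 : ℝ) else 0) := by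
  unfold primeRecipSumIn
  rw [← Finset.sum_filter_of_ne (p := fun k : ℕ => k.Prime ∧ k ∈ P) (s := Finset.Ioc ⌊v⌋₊ ⌊y⌋₊)
    (fun k _ hk => by by_contra h; exact hk (by rw [if_neg h, mul_zero]))]
  have hset : primesBetweenIn P v y =
      (Finset.Ioc ⌊v⌋₊ ⌊y⌋₊).filter fun k : ℕ => k.Prime ∧ k ∈ P := by
    ext p
    rw [mem_primesBetweenIn, Finset.mem_filter, Finset.mem_Ioc, Nat.floor_lt hv]
    constructor
    · rintro ⟨hp, hP, hvp, hpy⟩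
      exact ⟨⟨hvp, Nat.le_floor hpy⟩, hp, hP⟩
    · rintro ⟨⟨hvp, hpy⟩, hp, hP⟩
      exact ⟨hp, hP, hvp, (Nat.le_floor_iff' hp.ne_zero).1 hpy⟩
  rw [hset]
  refine Finset.sum_congr rfl fun k hk => ?_
  rw [if_pos (Finset.mem_filter.1 hk).2, one_div, mul_one]

/-- **Partial summation for `S(v, y; 𝒫)`** (`0 < v ≤ y`):
`S(v, y; 𝒫) = π(y; 𝒫)/y - π(v; 𝒫)/v + ∫_v^y π(t; 𝒫) t⁻² dt` — the identity behind
`S(v, y; 𝒮′) = (1/y)(π(y) - π(v)) + ∫_v^y t⁻²(π(t) - π(v)) dt` in the proof of LP92 Cor. 7.5.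
[cite: LenstraPomerance1992, §7 Corollary 7.5 (proof)] -/
theorem primeRecipSumIn_eq_sub_add_integral (P : Set ℕ) {v y : ℝ} (hv : 0 < v) (hvy : v ≤ y) :
    primeRecipSumIn P v y = (primeCountIn P y : ℝ) / y - (primeCountIn P v : ℝ) / v +
      ∫ t in Set.Ioc v y, (primeCountIn P t : ℝ) / t ^ 2 := by
  classical
  set c : ℕ → ℝ := fun k => if k.Prime ∧ k ∈ P then (1 : ℝ) else 0 with hc_def
  have hA : ∀ t : ℝ, ∑ k ∈ Icc 0 ⌊t⌋₊, c k = primeCountIn P t :=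
    fun t => sum_Icc_indicator_eq_primeCountIn P t
  have hdiff : ∀ t ∈ Set.Icc v y, DifferentiableAt ℝ (fun t : ℝ => t⁻¹) t := fun t ht =>
    (hasDerivAt_inv (hv.trans_le ht.1).ne').differentiableAt
  have hcont : ContinuousOn (fun t : ℝ => -(t ^ 2)⁻¹) (Set.Icc v y) := by
    refine ContinuousOn.neg (ContinuousOn.inv₀ (by fun_prop) fun t ht => ?_)
    exact pow_ne_zero 2 (hv.trans_le ht.1).ne'
  have hint : IntegrableOn (deriv fun t : ℝ => t⁻¹) (Set.Icc v y) := by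
    rw [deriv_inv']
    exact hcont.integrableOn_Icc
  have habel := sum_mul_eq_sub_sub_integral_mul c hv.le hvy hdiff hint
  rw [primeRecipSumIn_eq_sum_Ioc P hv.le, habel]
  simp only [hA, deriv_inv]
  have h1 : ∫ t in Set.Ioc v y, -(t ^ 2)⁻¹ * (primeCountIn P t : ℝ) =
      -∫ t in Set.Ioc v y, (primeCountIn P t : ℝ) / t ^ 2 := by
    rw [← integral_neg]
    exact integral_congr_ae (ae_of_all _ fun t => by ring)
  rw [h1]
  ring

/-- `π(·; 𝒫) t⁻²` is integrable on `(v, y]` (`0 < v`). [folklore] -/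
theorem integrableOn_primeCountIn_div_sq (P : Set ℕ) {v y : ℝ} (hv : 0 < v) :
    IntegrableOn (fun t : ℝ => (primeCountIn P t : ℝ) / t ^ 2) (Set.Ioc v y) := by
  classical
  have hcont : ContinuousOn (fun t : ℝ => (t ^ 2)⁻¹) (Set.Icc v y) := by
    refine ContinuousOn.inv₀ (by fun_prop) fun t ht => ?_
    exact pow_ne_zero 2 (hv.trans_le ht.1).ne'
  have := integrableOn_mul_sum_Icc (fun k : ℕ => if k.Prime ∧ k ∈ P then (1 : ℝ) else 0)
    (m := 0) hv.le hcont.integrableOn_Icc (b := y)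
  simp only [sum_Icc_indicator_eq_primeCountIn] at this
  refine (this.mono_set Set.Ioc_subset_Icc_self).congr_fun (fun t _ => ?_) measurableSet_Ioc
  simp only [div_eq_inv_mul]

/-- The weight `exp(-½ (log t)^{1/6})` of LP92 Thm. 7.4 is decreasing in `t ≥ 1`. [folklore] -/
theorem exp_neg_half_log_rpow_antitone {s t : ℝ} (hs : 1 ≤ s) (hst : s ≤ t) :
    Real.exp (-(1 / 2) * Real.log t ^ ((1 : ℝ) / 6)) ≤
      Real.exp (-(1 / 2) * Real.log s ^ ((1 : ℝ) / 6)) := by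
  have hls : 0 ≤ Real.log s := Real.log_nonneg hs
  have hlst : Real.log s ≤ Real.log t := Real.log_le_log (by linarith) hst
  have : Real.log s ^ ((1 : ℝ) / 6) ≤ Real.log t ^ ((1 : ℝ) / 6) :=
    Real.rpow_le_rpow hls hlst (by norm_num)
  exact Real.exp_le_exp.2 (by linarith)

/-- The weight is strictly decreasing: `1 ≤ s < t ⟹ weight(t) < weight(s)`. [folklore] -/
theorem exp_neg_half_log_rpow_strictAnti {s t : ℝ} (hs : 1 ≤ s) (hst : s < t) :
    Real.exp (-(1 / 2) * Real.log t ^ ((1 : ℝ) / 6)) <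
      Real.exp (-(1 / 2) * Real.log s ^ ((1 : ℝ) / 6)) := by
  have hls : 0 ≤ Real.log s := Real.log_nonneg hs
  have hlst : Real.log s < Real.log t := Real.log_lt_log (by linarith) hst
  have : Real.log s ^ ((1 : ℝ) / 6) < Real.log t ^ ((1 : ℝ) / 6) :=
    Real.rpow_lt_rpow hls hlst (by norm_num)
  exact Real.exp_lt_exp.2 (by linarith)

/-- **Lenstra–Pomerance 1992, Corollary 7.5 (from Theorem 7.4), for an arbitrary set of primes.**
Let `𝒫` be a set of primes and `c > 0` with `π(x; 𝒫) ≤ c x exp(-½ (log x)^{1/6})` for all real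
`x ≥ 2` (the conclusion of LP92 Thm. 7.4 for `𝒫 = 𝒮′`, with `c = c₇`). Then for `2 ≤ v < y`:
`S(v, y; 𝒫) < c exp(-½ (log v)^{1/6}) (1 + log(y/v))`.
[cite: LenstraPomerance1992, §7 Corollary 7.5 (p. 502)] -/
theorem primeRecipSumIn_lt_of_primeCountIn_le {P : Set ℕ} {c : ℝ} (hc : 0 < c)
    (hπ : ∀ x : ℝ, 2 ≤ x →
      (primeCountIn P x : ℝ) ≤ c * x * Real.exp (-(1 / 2) * Real.log x ^ ((1 : ℝ) / 6)))
    {v y : ℝ} (hv : 2 ≤ v) (hvy : v < y) :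
    primeRecipSumIn P v y <
      c * Real.exp (-(1 / 2) * Real.log v ^ ((1 : ℝ) / 6)) * (1 + Real.log (y / v)) := by
  set g : ℝ → ℝ := fun t => Real.exp (-(1 / 2) * Real.log t ^ ((1 : ℝ) / 6)) with hg
  have hv0 : 0 < v := by linarith
  have hy0 : 0 < y := by linarith
  rw [primeRecipSumIn_eq_sub_add_integral P hv0 hvy.le]
  -- the three terms
  have hT1 : (primeCountIn P y : ℝ) / y < c * g v := by
    rw [div_lt_iff₀ hy0]
    calc (primeCountIn P y : ℝ) ≤ c * y * g y := hπ y (by linarith)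
      _ < c * y * g v := by
          refine mul_lt_mul_of_pos_left ?_ (by positivity)
          exact exp_neg_half_log_rpow_strictAnti (by linarith) hvy
      _ = c * g v * y := by ring
  have hT2 : 0 ≤ (primeCountIn P v : ℝ) / v := by positivity
  have hT3 : ∫ t in Set.Ioc v y, (primeCountIn P t : ℝ) / t ^ 2 ≤ c * g v * Real.log (y / v) := by
    have hIinv : IntegrableOn (fun t : ℝ => c * g v * t⁻¹) (Set.Ioc v y) := by
      refine (ContinuousOn.integrableOn_Icc ?_).mono_set Set.Ioc_subset_Icc_self
      refine ContinuousOn.mul continuousOn_const (ContinuousOn.inv₀ continuousOn_id fun t ht => ?_)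
      exact (hv0.trans_le ht.1).ne'
    calc ∫ t in Set.Ioc v y, (primeCountIn P t : ℝ) / t ^ 2
        ≤ ∫ t in Set.Ioc v y, c * g v * t⁻¹ := by
          refine setIntegral_mono_on (integrableOn_primeCountIn_div_sq P hv0) hIinv
            measurableSet_Ioc fun t ht => ?_
          have ht0 : 0 < t := hv0.trans ht.1
          have h1 : (primeCountIn P t : ℝ) ≤ c * t * g t := hπ t (by linarith [ht.1])
          have h2 : g t ≤ g v := exp_neg_half_log_rpow_antitone (by linarith) ht.1.le
          rw [div_le_iff₀ (by positivity)]
          calc (primeCountIn P t : ℝ) ≤ c * t * g t := h1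
            _ ≤ c * t * g v := mul_le_mul_of_nonneg_left h2 (by positivity)
            _ = c * g v * t⁻¹ * t ^ 2 := by field_simp
      _ = c * g v * Real.log (y / v) := by
          rw [← intervalIntegral.integral_of_le hvy.le, intervalIntegral.integral_const_mul,
            integral_inv (Set.notMem_uIcc_of_lt hv0 hy0)]
  have hlog : 0 ≤ Real.log (y / v) := Real.log_nonneg (by rw [le_div_iff₀ hv0]; linarith)
  nlinarith [hT1, hT2, hT3, mul_pos hc (Real.exp_pos (-(1 / 2) * Real.log v ^ ((1 : ℝ) / 6)))]

/-- **Corollary 7.5, non-strict form** (convenient downstream, e.g. in the proof of LP92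
Thm. 8.1): under the hypothesis of Thm. 7.4 for `𝒫`, for `2 ≤ v ≤ y`,
`S(v, y; 𝒫) ≤ c exp(-½ (log v)^{1/6}) (1 + log(y/v))`.
[cite: LenstraPomerance1992, §7 Corollary 7.5 (p. 502)] -/
theorem primeRecipSumIn_le_of_primeCountIn_le {P : Set ℕ} {c : ℝ} (hc : 0 < c)
    (hπ : ∀ x : ℝ, 2 ≤ x →
      (primeCountIn P x : ℝ) ≤ c * x * Real.exp (-(1 / 2) * Real.log x ^ ((1 : ℝ) / 6)))
    {v y : ℝ} (hv : 2 ≤ v) (hvy : v ≤ y) :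
    primeRecipSumIn P v y ≤
      c * Real.exp (-(1 / 2) * Real.log v ^ ((1 : ℝ) / 6)) * (1 + Real.log (y / v)) := by
  rcases hvy.lt_or_eq with hlt | heq
  · exact (primeRecipSumIn_lt_of_primeCountIn_le hc hπ hv hlt).le
  · subst heq
    have h0 : primeRecipSumIn P v v = 0 := by
      unfold primeRecipSumIn
      refine Finset.sum_eq_zero fun p hp => ?_
      obtain ⟨-, -, h1, h2⟩ := mem_primesBetweenIn.1 hp
      linarith
    rw [h0, div_self (by linarith : v ≠ 0), Real.log_one, add_zero, mul_one]
    positivity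

end LenstraPomerance
end Literature.NumberTheory.Sieve
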